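import Summits.AnomalousDissipation.AnomalousDissipation.Theorems.SolenoidalFractalHomogenisationLagrangianStepSidebandXDefs
import Summits.AnomalousDissipation.AnomalousDissipation.Theorems.SolenoidalFractalHomogenisationLagrangianStepSidebandResponseExt
import HarnessLib

/-!
# K1L_D `LagrangianRenormalisationStepDesign` (stmt-AnomalousDissipation-27980), `stub_D1_V0` (V0 = clause (ii) of
# `WCrossing.D1ExactFamily`), brick T4c-3d/T4d: THE REFERENCE STATE, THE RESIDUAL AND THE OUTSIDE-TAIL ENERGY of the box-truncated sideband
# vector of a weak solution (shared definitions; reviewed; `--kind definition --supports stmt-AnomalousDissipation-27980 --as helper`)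

Summits-side DEFINITIONS file of route `SolenoidalFractalHomogenisation` (prover seat `ad-k1l-cellLawV-w1` g7), the three objects of the
residual energy inequality (memo `Cruxes/LagrangianRenormalisationStepDesign/Lines/onelevel-V0-residual.md` §1–§3, typed skeleton
`…/Lines/onelevel_V0_energy.lean`, where they were local to the crux workfile).  With `𝔹 = (1/n²)•𝔸`, psiStar's reference data (tensor `𝔸`,
`γ₁ = 1`, truncation `R`), `Z t = sbVec W₁ n 𝔹 F w ℓ R t`, `x t = modeRep W₁ n 𝔹 F w ℓ t`, `Nⱼ = responseExt W₁ 𝔸 1 R j`, `ξⱼ = xiCoeff W₁ n ℓ j`: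
* `refState W₁ n ℓ 𝔸 R F w t = Σⱼ ξⱼ • Nⱼ t (x t)` — the reference state `y`;
* `residualX W₁ n ℓ 𝔸 R F w t = Z t − projX n ℓ R (y t)` — the residual `r` of THE weak solution against the class-transversal reference
  (`…SidebandXResidual.hasDerivWithinAt_residual`);
* `tailEnergy W₁ n ℓ 𝔸 R F w t = Σ_{z ∈ box} (Σⱼ ‖αⱼ‖(‖[z−mⱼ ∉ box ∪ {0}]·x(k_{z−mⱼ},t)‖ + ‖[z+mⱼ ∉ box ∪ {0}]·x(k_{z+mⱼ},t)‖))²` — the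
  outside-tail energy (the source left by `…SidebandXTail.two_abs_re_inner_tail_le` after the Young split against the dissipation weight).
Definitions with bodies and unfolding lemmas only; no theorem of substance, no named fact, no sorry.  NOT a proof of anything; rung F-D1.A0
infrastructure.  AD is not proved.
-/

set_option linter.dupNamespace false

noncomputable section

namespace Summit.AnomalousDissipation.AnomalousDissipation.Theorems.SolenoidalFractalHomogenisation.LagrangianStep.Sideband

open Set MeasureTheory Complex UnitAddTorus
open scoped InnerProductSpace
open Literature.Analysis Literature.Analysis.FunctionSpaces Literature.Analysis.FunctionSpaces.Torus
open Literature.Analysis.FluidPDE Literature.Analysis.FluidPDE.Torus Literature.Analysis.FluidPDE.LatticeShear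
open Summit.AnomalousDissipation.AnomalousDissipation.Theorems.SolenoidalFractalHomogenisation.LagrangianStep.CellChain (modeRep)

variable {k₀ : ℕ}

/-! ## §1 The reference state and the residual -/

/-- **The reference state** `y t = Σⱼ ξⱼ • Nⱼ t (x t)` (`Nⱼ = responseExt W₁ 𝔸 1 R j`, `x t = modeRep … ℓ t` for `𝔹 = (1/n²)•𝔸`).
[cite: SandersVerhulstMurdock2007, Lemma 5.2.7 (linear case)] [cite: MajdaKramer1999, §2.2.1.3 (cell problem (49))] -/
def refState (W₁ : LatticeWord k₀) (n : ℕ) (ℓ : Fin 3 → ℤ) (𝔸 : Torus.Visc4 (Fin 3)) (R : ℕ)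
    (F : UnitAddTorus (Fin 3) → EuclideanSpace ℝ (Fin 3)) (w : ℝ → UnitAddTorus (Fin 3) → EuclideanSpace ℝ (Fin 3)) (t : ℝ) : Space R :=
  ∑ j, ((xiCoeff W₁ n ℓ j : ℝ) : ℂ) • responseExt W₁ 𝔸 1 R j t (modeRep W₁ n ((1 / (n : ℝ) ^ 2) • 𝔸) F w ℓ t)

/-- Unfolding `refState`. [cite: SandersVerhulstMurdock2007, Lemma 5.2.7 (linear case)] -/
theorem refState_def (W₁ : LatticeWord k₀) (n : ℕ) (ℓ : Fin 3 → ℤ) (𝔸 : Torus.Visc4 (Fin 3)) (R : ℕ)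
    (F : UnitAddTorus (Fin 3) → EuclideanSpace ℝ (Fin 3)) (w : ℝ → UnitAddTorus (Fin 3) → EuclideanSpace ℝ (Fin 3)) (t : ℝ) :
    refState W₁ n ℓ 𝔸 R F w t =
      ∑ j, ((xiCoeff W₁ n ℓ j : ℝ) : ℂ) • responseExt W₁ 𝔸 1 R j t (modeRep W₁ n ((1 / (n : ℝ) ^ 2) • 𝔸) F w ℓ t) := rfl

/-- **The residual** `r t = Z t − projX n ℓ R (y t)` of the box-truncated sideband vector of the weak solution against the class-transversal
reference. [cite: SandersVerhulstMurdock2007, Lemma 5.2.7 (linear case)] [cite: MajdaKramer1999, §2.2.1.3 (cell problem (49))] -/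
def residualX (W₁ : LatticeWord k₀) (n : ℕ) (ℓ : Fin 3 → ℤ) (𝔸 : Torus.Visc4 (Fin 3)) (R : ℕ)
    (F : UnitAddTorus (Fin 3) → EuclideanSpace ℝ (Fin 3)) (w : ℝ → UnitAddTorus (Fin 3) → EuclideanSpace ℝ (Fin 3)) (t : ℝ) : Space R :=
  sbVec W₁ n ((1 / (n : ℝ) ^ 2) • 𝔸) F w ℓ R t - projX n ℓ R (refState W₁ n ℓ 𝔸 R F w t)

/-- Unfolding `residualX` (as a function of time, in the shape of `…SidebandXResidual.hasDerivWithinAt_residual`).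
[cite: SandersVerhulstMurdock2007, Lemma 5.2.7 (linear case)] -/
theorem residualX_eq (W₁ : LatticeWord k₀) (n : ℕ) (ℓ : Fin 3 → ℤ) (𝔸 : Torus.Visc4 (Fin 3)) (R : ℕ)
    (F : UnitAddTorus (Fin 3) → EuclideanSpace ℝ (Fin 3)) (w : ℝ → UnitAddTorus (Fin 3) → EuclideanSpace ℝ (Fin 3)) :
    residualX W₁ n ℓ 𝔸 R F w = fun τ => sbVec W₁ n ((1 / (n : ℝ) ^ 2) • 𝔸) F w ℓ R τ -
      projX n ℓ R (∑ j, ((xiCoeff W₁ n ℓ j : ℝ) : ℂ) • responseExt W₁ 𝔸 1 R j τ (modeRep W₁ n ((1 / (n : ℝ) ^ 2) • 𝔸) F w ℓ τ)) := rfl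

/-- Unfolding `residualX` at a time. [cite: SandersVerhulstMurdock2007, Lemma 5.2.7 (linear case)] -/
theorem residualX_apply (W₁ : LatticeWord k₀) (n : ℕ) (ℓ : Fin 3 → ℤ) (𝔸 : Torus.Visc4 (Fin 3)) (R : ℕ)
    (F : UnitAddTorus (Fin 3) → EuclideanSpace ℝ (Fin 3)) (w : ℝ → UnitAddTorus (Fin 3) → EuclideanSpace ℝ (Fin 3)) (t : ℝ) :
    residualX W₁ n ℓ 𝔸 R F w t = sbVec W₁ n ((1 / (n : ℝ) ^ 2) • 𝔸) F w ℓ R t - projX n ℓ R (refState W₁ n ℓ 𝔸 R F w t) := rfl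

/-! ## §2 The outside-tail energy -/

open Classical in
/-- **The outside-tail energy at time `t`**: `Σ_{z ∈ box} (Σⱼ ‖αⱼ‖(‖[z−mⱼ ∉ box ∪ {0}]·x(k_{z−mⱼ},t)‖ + ‖[z+mⱼ ∉ box ∪ {0}]·x(k_{z+mⱼ},t)‖))²`
(only class modes OUTSIDE the box within `max|mⱼ|` of its boundary enter). [cite: MajdaKramer1999, §2.2.1.3 (cell problem (49))]
[cite: Temam1984, Ch. III §1 Lemma 1.2 (energy inequality)] -/
def tailEnergy (W₁ : LatticeWord k₀) (n : ℕ) (ℓ : Fin 3 → ℤ) (𝔸 : Torus.Visc4 (Fin 3)) (R : ℕ)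
    (F : UnitAddTorus (Fin 3) → EuclideanSpace ℝ (Fin 3)) (w : ℝ → UnitAddTorus (Fin 3) → EuclideanSpace ℝ (Fin 3)) (t : ℝ) : ℝ :=
  ∑ z : box R, (∑ j, ‖slotAmp W₁ j‖ *
    (‖(if (z.1 - (W₁.phase j).m ∉ box R ∧ z.1 - (W₁.phase j).m ≠ 0) then
        modeRep W₁ n ((1 / (n : ℝ) ^ 2) • 𝔸) F w (classFreq n ℓ (z.1 - (W₁.phase j).m)) t else 0)‖ +
     ‖(if (z.1 + (W₁.phase j).m ∉ box R ∧ z.1 + (W₁.phase j).m ≠ 0) then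
        modeRep W₁ n ((1 / (n : ℝ) ^ 2) • 𝔸) F w (classFreq n ℓ (z.1 + (W₁.phase j).m)) t else 0)‖)) ^ 2

open Classical in
/-- Unfolding `tailEnergy`. [cite: MajdaKramer1999, §2.2.1.3 (cell problem (49))] -/
theorem tailEnergy_def (W₁ : LatticeWord k₀) (n : ℕ) (ℓ : Fin 3 → ℤ) (𝔸 : Torus.Visc4 (Fin 3)) (R : ℕ)
    (F : UnitAddTorus (Fin 3) → EuclideanSpace ℝ (Fin 3)) (w : ℝ → UnitAddTorus (Fin 3) → EuclideanSpace ℝ (Fin 3)) (t : ℝ) :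
    tailEnergy W₁ n ℓ 𝔸 R F w t =
      ∑ z : box R, (∑ j, ‖slotAmp W₁ j‖ *
        (‖(if (z.1 - (W₁.phase j).m ∉ box R ∧ z.1 - (W₁.phase j).m ≠ 0) then
            modeRep W₁ n ((1 / (n : ℝ) ^ 2) • 𝔸) F w (classFreq n ℓ (z.1 - (W₁.phase j).m)) t else 0)‖ +
         ‖(if (z.1 + (W₁.phase j).m ∉ box R ∧ z.1 + (W₁.phase j).m ≠ 0) then
            modeRep W₁ n ((1 / (n : ℝ) ^ 2) • 𝔸) F w (classFreq n ℓ (z.1 + (W₁.phase j).m)) t else 0)‖)) ^ 2 := rfl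

/-- The outside-tail energy is non-negative. [cite: MajdaKramer1999, §2.2.1.3 (cell problem (49))] -/
theorem tailEnergy_nonneg (W₁ : LatticeWord k₀) (n : ℕ) (ℓ : Fin 3 → ℤ) (𝔸 : Torus.Visc4 (Fin 3)) (R : ℕ)
    (F : UnitAddTorus (Fin 3) → EuclideanSpace ℝ (Fin 3)) (w : ℝ → UnitAddTorus (Fin 3) → EuclideanSpace ℝ (Fin 3)) (t : ℝ) :
    0 ≤ tailEnergy W₁ n ℓ 𝔸 R F w t :=
  Finset.sum_nonneg fun _ _ => sq_nonneg _

end Summit.AnomalousDissipation.AnomalousDissipation.Theorems.SolenoidalFractalHomogenisation.LagrangianStep.Sideband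

end
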